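/-
Summits.ResolutionOfSingularities.HardCores — GENERATED by harness/kit/hardcore_registry.py (2026-08-18T11:48:14Z) from harness/kit/hardcore_seeds.json (FILTER-SYNTHESIS 2026-08-18 F1).
Tags existing OPEN statement items as famous open sub-summit problems (`@[hard_core]`); the kernel tribunal (t1h) flags routes whose crux meets one
(frontier shelf, never a fail; the owner route is exempt). 4 item(s) tagged; 0 unresolved: []
NEVER import this from a Theorems/Theses/Cruxes file.
-/
import Summits.ResolutionOfSingularities.ResolutionOfSingularities.Theses.Descent
import Summits.ResolutionOfSingularities.ResolutionOfSingularities.Theses.ShadowGame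
import Summits.ResolutionOfSingularities.ResolutionOfSingularities.Theses.Valuative
import HarnessLib.Audit.TribunalTags

-- stmt-ResolutionOfSingularities-0549 · descent_perfect_to_all · descent of resolution from perfect to all fields / patching
attribute [hard_core "ResolutionOfSingularities" "descent of resolution from perfect to all fields / patching"] Summit.ResolutionOfSingularities.ResolutionOfSingularities.Theses.Descent.DescentPerfectToAll
-- stmt-ResolutionOfSingularities-0550 · descent_algclosed_to_perfect · descent of resolution from perfect to all fields / patching
attribute [hard_core "ResolutionOfSingularities" "descent of resolution from perfect to all fields / patching"] Summit.ResolutionOfSingularities.ResolutionOfSingularities.Theses.Descent.DescentAlgclosedToPerfect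
-- stmt-ResolutionOfSingularities-16161 · PatchingRelPerfect · descent of resolution from perfect to all fields / patching
attribute [hard_core "ResolutionOfSingularities" "descent of resolution from perfect to all fields / patching"] Summit.ResolutionOfSingularities.ResolutionOfSingularities.Theses.ShadowGame.PatchingRelPerfect
-- stmt-ResolutionOfSingularities-0642 · patching_rel · descent of resolution from perfect to all fields / patching
attribute [hard_core "ResolutionOfSingularities" "descent of resolution from perfect to all fields / patching"] Summit.ResolutionOfSingularities.ResolutionOfSingularities.Theses.Valuative.PatchingRel
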